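import Summits.CriticalPhenomena.PercolationContinuityZ3.Theorems.PercNearOneGluingNoHeavyLowerTailSahiGridPatternYProfile
import Summits.CriticalPhenomena.PercolationContinuityZ3.Theorems.PercNearOneGluingNoHeavyLowerTailSahiGridPatternFaces

/-!
# `NoHeavyLowerTail` (crux stmt-CriticalPhenomena-4575), Sahi programme: **PAIR SATURATION** — `PatternPos d` reduced, in every
# dimension, to the dual-cone membership of the y-profile of MUTUALLY SATURATED PAIRS of up-sets

Support file (Sahi cell `prim-sahi`, seat `prim-sahi-typer` gen 31; `--supports stmt-CriticalPhenomena-4575`).  Pure proofs; the only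
definitions are bookkeeping (`InDual`, `coGen`, `minEl`, `ptRank`, `phi`, `Free`) and the two predicates `IsNF`, `PairCond`; no `sorry`,
standard axioms.  This is the dimension-free half of the proof of the cell `(4,3)` (`PatternPos 4`); the `d = 4` half is a finite check.

THE MATHEMATICS (every `d`; `P = [3]^d`, `S = sStarD`, `P_y(A,B)` the y-profile of `…SahiGridPatternYProfile`, so that
`S(A,B,C) = Σ_{y∈C} P_y(A,B)` and `P_y(A,B) ≥ 0` iff `y ∈ A ∩ B` for up-sets `A, B`).
* MOVES.  For up-sets `A,B,C`: if `x` is a maximal non-element of `A` (`coGen`) with `x ∉ B ∩ C`, then `insert x A` is an up-set and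
  `S(insert x A,B,C) = S(A,B,C) + P_x(B,C) ≤ S(A,B,C)`; if `m` is a minimal element of `A` with `m ∈ B ∩ C`, then `A.erase m` is an
  up-set and `S(A.erase m,B,C) = S(A,B,C) − P_m(B,C) ≤ S(A,B,C)` (and the same in the other two slots, `S` being symmetric).  Each move
  lowers the potential `phi = Σ_x ptRank` (a point in none of the sets counts 2, in exactly one or in all three counts 1, in exactly two
  counts 0), so every triple of up-sets dominates a triple in NORMAL FORM (`IsNF`: no move applies; `exists_isNF_le`).
* In normal form the three sets of maximal non-elements are pairwise disjoint with an antichain union, every minimal element of `A`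
  lying in `B` is incomparable to all maximal non-elements of `A` and of `B` (it is outside `C`), and the maximal non-elements of `C`
  form an antichain of points incomparable to those of `A` and `B`.  Permuting the slots so that `C` has the most maximal non-elements,
  the pair `(A,B)` satisfies `PairCond` (`pairCond_of_isNF`).
* **`patternPos_of_pairCond`**: if the y-profile of every pair satisfying `PairCond` lies in the dual cone of the up-sets (`InDual`),
  then `PatternPos d`.  (`InDual (yProfile A B)` for ALL pairs of up-sets is equivalent to `PatternPos d`; the point is that only the
  mutually saturated pairs with a large free antichain need to be examined — at `d = 4`, `3.1·10^7` pairs up to symmetry.)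
* `inDual_of_transfer`: the elementary soundness of DOWNWARD TRANSPORT — moving a nonnegative amount from `w` down to `y ≤ w` can only
  lower sums over up-sets, so a profile that becomes pointwise nonnegative after such transfers lies in the dual cone.
Nothing here is specific to `d = 4` and nothing conjectural is asserted. [this work]
-/

namespace Summit.CriticalPhenomena.PercolationContinuityZ3.Theorems.SahiGridPattern

open Finset SahiGrid3
open scoped BigOperators Classical

variable {d : ℕ}

/-! ### The dual cone of the up-sets and downward transport -/

/-- `InDual c`: the function `c` on `[3]^d` lies in the dual cone of the up-sets (`Σ_{y∈U} c y ≥ 0` for every up-set `U`). [this work] -/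
def InDual (c : Pd d → ℤ) : Prop := ∀ U : Finset (Pd d), IsUpperSet (U : Set (Pd d)) → 0 ≤ ∑ y ∈ U, c y

/-- If the y-profile of `(A,B)` lies in the dual cone then `sStarD A B C ≥ 0` for every up-set `C`. [this work] -/
theorem sStarD_nonneg_of_inDual {A B C : Finset (Pd d)} (h : InDual (yProfile A B)) (hC : IsUpperSet (C : Set (Pd d))) :
    0 ≤ sStarD A B C := by
  rw [sStarD_eq_sum_yProfile]; exact h C hC

/-- A pointwise nonnegative function lies in the dual cone. [this work] -/
theorem inDual_of_nonneg {c : Pd d → ℤ} (h : ∀ y, 0 ≤ c y) : InDual c := fun _ _ => Finset.sum_nonneg fun y _ => h y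

/-- One downward transfer: move `a` units from `w` to `y`. [this work] -/
def transfer (c : Pd d → ℤ) (w y : Pd d) (a : ℤ) : Pd d → ℤ :=
  fun x => c x - (if x = w then a else 0) + (if x = y then a else 0)

/-- **Soundness of downward transport**: if `y ≤ w`, `a ≥ 0` and the transferred function lies in the dual cone, so does `c`. [this work] -/
theorem inDual_of_transfer {c : Pd d → ℤ} {w y : Pd d} {a : ℤ} (hyw : y ≤ w) (ha : 0 ≤ a) (h : InDual (transfer c w y a)) :
    InDual c := by
  intro U hU
  have hle : ∑ x ∈ U, transfer c w y a x ≤ ∑ x ∈ U, c x := by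
    unfold transfer
    rw [Finset.sum_add_distrib, Finset.sum_sub_distrib, Finset.sum_ite_eq' U w, Finset.sum_ite_eq' U y]
    by_cases hy : y ∈ U
    · have hw : w ∈ U := hU hyw hy
      rw [if_pos hy, if_pos hw]; linarith
    · rw [if_neg hy]; split_ifs <;> linarith
  exact le_trans (h U hU) hle

/-! ### Maximal non-elements, minimal elements, and the two moves -/

/-- `coGen A`: the maximal elements of the complement of `A` (for an up-set `A`: its co-generators). [this work] -/
noncomputable def coGen (A : Finset (Pd d)) : Finset (Pd d) := univ.filter fun x => x ∉ A ∧ ∀ y, x < y → y ∈ A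

/-- `minEl A`: the minimal elements of `A`. [this work] -/
noncomputable def minEl (A : Finset (Pd d)) : Finset (Pd d) := A.filter fun x => ∀ y, y < x → y ∉ A

/-- Membership in `coGen`. [this work] -/
theorem mem_coGen {A : Finset (Pd d)} {x : Pd d} : x ∈ coGen A ↔ x ∉ A ∧ ∀ y, x < y → y ∈ A := by
  unfold coGen; simp only [mem_filter, mem_univ, true_and]

/-- Membership in `minEl`. [this work] -/
theorem mem_minEl {A : Finset (Pd d)} {x : Pd d} : x ∈ minEl A ↔ x ∈ A ∧ ∀ y, y < x → y ∉ A := by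
  unfold minEl; rw [mem_filter]

/-- `coGen A` is an antichain. [this work] -/
theorem isAntichain_coGen (A : Finset (Pd d)) : IsAntichain (· ≤ ·) (coGen A : Set (Pd d)) := by
  intro x hx y hy hne hle
  rw [Finset.mem_coe, mem_coGen] at hx hy
  exact hy.1 (hx.2 y (lt_of_le_of_ne hle hne))

/-- Adding a maximal non-element to an up-set gives an up-set. [this work] -/
theorem isUpperSet_insert_of_mem_coGen {A : Finset (Pd d)} (hA : IsUpperSet (A : Set (Pd d))) {x : Pd d} (hx : x ∈ coGen A) :
    IsUpperSet ((insert x A : Finset (Pd d)) : Set (Pd d)) := by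
  intro u v huv hu
  rw [Finset.mem_coe, mem_insert] at hu ⊢
  rcases hu with rfl | hu
  · rcases eq_or_lt_of_le huv with rfl | hlt
    · exact Or.inl rfl
    · exact Or.inr ((mem_coGen.1 hx).2 v hlt)
  · exact Or.inr (hA huv hu)

/-- Removing a minimal element from an up-set gives an up-set. [this work] -/
theorem isUpperSet_erase_of_mem_minEl {A : Finset (Pd d)} (hA : IsUpperSet (A : Set (Pd d))) {m : Pd d} (hm : m ∈ minEl A) :
    IsUpperSet ((A.erase m : Finset (Pd d)) : Set (Pd d)) := by
  intro u v huv hu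
  rw [Finset.mem_coe, mem_erase] at hu ⊢
  refine ⟨fun hvm => ?_, hA huv hu.2⟩
  subst hvm
  exact (mem_minEl.1 hm).2 u (lt_of_le_of_ne huv hu.1) hu.2

/-- The tensor is invariant under the cyclic shift of its arguments. [this work] -/
theorem tcD_cycle (p q r : Pd d) : tcD p q r = tcD q r p := by
  rw [tcD_swap12, tcD_swap23]

/-- **First-slot insertion**: `S(insert x A, B, C) = S(A,B,C) + P_x(B,C)` for `x ∉ A`. [this work] -/
theorem sStarD_insert₁ {A : Finset (Pd d)} {x : Pd d} (hx : x ∉ A) (B C : Finset (Pd d)) :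
    sStarD (insert x A) B C = sStarD A B C + yProfile B C x := by
  rw [sStarD_eq_sum_tcD, sStarD_eq_sum_tcD, Finset.sum_insert hx, add_comm]
  unfold yProfile
  congr 1
  rw [Finset.sum_comm]
  exact Finset.sum_congr rfl fun r _ => Finset.sum_congr rfl fun q _ => tcD_cycle x q r

/-- First-slot removal: `S(A,B,C) = S(A.erase m, B, C) + P_m(B,C)` for `m ∈ A`. [this work] -/
theorem sStarD_erase₁ {A : Finset (Pd d)} {m : Pd d} (hm : m ∈ A) (B C : Finset (Pd d)) :
    sStarD A B C = sStarD (A.erase m) B C + yProfile B C m := by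
  rw [← sStarD_insert₁ (Finset.notMem_erase m A) B C, Finset.insert_erase hm]

/-! ### The potential -/

/-- Point rank: 2 if the point is in none of the three sets, 1 if it is in exactly one or in all three, 0 if in exactly two. [this work] -/
def ptRank (A B C : Finset (Pd d)) (x : Pd d) : ℕ :=
  if (if x ∈ A then 1 else 0) + (if x ∈ B then 1 else 0) + (if x ∈ C then 1 else 0) = 0 then 2
  else if (if x ∈ A then 1 else 0) + (if x ∈ B then 1 else 0) + (if x ∈ C then 1 else 0) = 2 then 0 else 1

/-- The potential `phi = Σ_x ptRank`. [this work] -/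
def phi (A B C : Finset (Pd d)) : ℕ := ∑ x, ptRank A B C x

/-- `ptRank` is symmetric in the first two sets. [this work] -/
theorem ptRank_swap12 (A B C : Finset (Pd d)) (x : Pd d) : ptRank A B C x = ptRank B A C x := by
  unfold ptRank; rw [add_comm (if x ∈ A then 1 else 0) (if x ∈ B then 1 else 0)]

/-- `ptRank` is symmetric in the last two sets. [this work] -/
theorem ptRank_swap23 (A B C : Finset (Pd d)) (x : Pd d) : ptRank A B C x = ptRank A C B x := by
  unfold ptRank; rw [add_assoc, add_comm (if x ∈ B then 1 else 0) (if x ∈ C then 1 else 0), ← add_assoc]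

/-- `phi` is symmetric in the first two sets. [this work] -/
theorem phi_swap12 (A B C : Finset (Pd d)) : phi A B C = phi B A C :=
  Finset.sum_congr rfl fun x _ => ptRank_swap12 A B C x

/-- `phi` is symmetric in the last two sets. [this work] -/
theorem phi_swap23 (A B C : Finset (Pd d)) : phi A B C = phi A C B :=
  Finset.sum_congr rfl fun x _ => ptRank_swap23 A B C x

/-- The potential drops when a point outside `A` and outside `B ∩ C` is added to `A`. [this work] -/
theorem phi_insert_lt {A B C : Finset (Pd d)} {x : Pd d} (hx : x ∉ A) (hbc : ¬ (x ∈ B ∧ x ∈ C)) :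
    phi (insert x A) B C < phi A B C := by
  unfold phi
  rw [← Finset.add_sum_erase univ _ (mem_univ x), ← Finset.add_sum_erase univ (ptRank A B C) (mem_univ x)]
  have hrest : ∑ z ∈ univ.erase x, ptRank (insert x A) B C z = ∑ z ∈ univ.erase x, ptRank A B C z := by
    refine Finset.sum_congr rfl fun z hz => ?_
    have hzx : z ≠ x := (mem_erase.1 hz).1
    unfold ptRank; simp only [mem_insert, hzx, false_or]
  rw [hrest]
  have hlt : ptRank (insert x A) B C x < ptRank A B C x := by
    unfold ptRank
    simp only [mem_insert, true_or, if_true, hx, if_false]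
    by_cases hb : x ∈ B <;> by_cases hc : x ∈ C <;> simp [hb, hc] at hbc ⊢
  omega

/-- The potential drops when a point of `A ∩ B ∩ C` is removed from `A`. [this work] -/
theorem phi_erase_lt {A B C : Finset (Pd d)} {m : Pd d} (hm : m ∈ A) (hb : m ∈ B) (hc : m ∈ C) :
    phi (A.erase m) B C < phi A B C := by
  unfold phi
  rw [← Finset.add_sum_erase univ _ (mem_univ m), ← Finset.add_sum_erase univ (ptRank A B C) (mem_univ m)]
  have hrest : ∑ z ∈ univ.erase m, ptRank (A.erase m) B C z = ∑ z ∈ univ.erase m, ptRank A B C z := by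
    refine Finset.sum_congr rfl fun z hz => ?_
    have hzm : z ≠ m := (mem_erase.1 hz).1
    unfold ptRank; simp only [mem_erase, hzm, ne_eq, not_false_eq_true, true_and]
  rw [hrest]
  have hlt : ptRank (A.erase m) B C m < ptRank A B C m := by
    unfold ptRank
    simp [hm, hb, hc]
  omega

/-! ### Normal form -/

/-- **Normal form** of a triple of up-sets: every maximal non-element of each set lies in the other two sets, and no minimal element
of a set lies in both other sets (neither move applies). [this work] -/
structure IsNF (A B C : Finset (Pd d)) : Prop where
  upA : IsUpperSet (A : Set (Pd d))
  upB : IsUpperSet (B : Set (Pd d))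
  upC : IsUpperSet (C : Set (Pd d))
  s1A : ∀ x ∈ coGen A, x ∈ B ∧ x ∈ C
  s1B : ∀ x ∈ coGen B, x ∈ A ∧ x ∈ C
  s1C : ∀ x ∈ coGen C, x ∈ A ∧ x ∈ B
  s2A : ∀ m ∈ minEl A, ¬ (m ∈ B ∧ m ∈ C)
  s2B : ∀ m ∈ minEl B, ¬ (m ∈ A ∧ m ∈ C)
  s2C : ∀ m ∈ minEl C, ¬ (m ∈ A ∧ m ∈ B)

/-- Normal form is symmetric in the first two slots. [this work] -/
theorem IsNF.swap12 {A B C : Finset (Pd d)} (h : IsNF A B C) : IsNF B A C where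
  upA := h.upB
  upB := h.upA
  upC := h.upC
  s1A := fun x hx => ⟨(h.s1B x hx).1, (h.s1B x hx).2⟩
  s1B := fun x hx => ⟨(h.s1A x hx).1, (h.s1A x hx).2⟩
  s1C := fun x hx => ⟨(h.s1C x hx).2, (h.s1C x hx).1⟩
  s2A := fun m hm hh => h.s2B m hm ⟨hh.1, hh.2⟩
  s2B := fun m hm hh => h.s2A m hm ⟨hh.1, hh.2⟩
  s2C := fun m hm hh => h.s2C m hm ⟨hh.2, hh.1⟩

/-- Normal form is symmetric in the last two slots. [this work] -/
theorem IsNF.swap23 {A B C : Finset (Pd d)} (h : IsNF A B C) : IsNF A C B where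
  upA := h.upA
  upB := h.upC
  upC := h.upB
  s1A := fun x hx => ⟨(h.s1A x hx).2, (h.s1A x hx).1⟩
  s1B := fun x hx => ⟨(h.s1C x hx).1, (h.s1C x hx).2⟩
  s1C := fun x hx => ⟨(h.s1B x hx).1, (h.s1B x hx).2⟩
  s2A := fun m hm hh => h.s2A m hm ⟨hh.2, hh.1⟩
  s2B := fun m hm hh => h.s2C m hm ⟨hh.1, hh.2⟩
  s2C := fun m hm hh => h.s2B m hm ⟨hh.1, hh.2⟩

/-- A triple of up-sets with smaller `sStarD` and smaller potential. [this work] -/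
def Better (A B C : Finset (Pd d)) : Prop :=
  ∃ A' B' C' : Finset (Pd d), IsUpperSet (A' : Set (Pd d)) ∧ IsUpperSet (B' : Set (Pd d)) ∧ IsUpperSet (C' : Set (Pd d)) ∧
    sStarD A' B' C' ≤ sStarD A B C ∧ phi A' B' C' < phi A B C

/-- `Better` transported along the swap of the first two slots. [this work] -/
theorem Better.swap12 {A B C : Finset (Pd d)} (h : Better B A C) : Better A B C := by
  obtain ⟨A', B', C', hA', hB', hC', hS, hφ⟩ := h
  refine ⟨B', A', C', hB', hA', hC', ?_, ?_⟩
  · rw [sStarD_swap12 B' A' C', sStarD_swap12 A B C]; exact hS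
  · rw [phi_swap12 B' A' C', phi_swap12 A B C]; exact hφ

/-- `Better` transported along the swap of the last two slots. [this work] -/
theorem Better.swap23 {A B C : Finset (Pd d)} (h : Better A C B) : Better A B C := by
  obtain ⟨A', B', C', hA', hB', hC', hS, hφ⟩ := h
  refine ⟨A', C', B', hA', hC', hB', ?_, ?_⟩
  · rw [sStarD_swap23 A' C' B', sStarD_swap23 A B C]; exact hS
  · rw [phi_swap23 A' C' B', phi_swap23 A B C]; exact hφ

/-- Move S1 in the first slot. [this work] -/
theorem better_of_coGen₁ {A B C : Finset (Pd d)} (hA : IsUpperSet (A : Set (Pd d))) (hB : IsUpperSet (B : Set (Pd d)))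
    (hC : IsUpperSet (C : Set (Pd d))) {x : Pd d} (hx : x ∈ coGen A) (hbc : ¬ (x ∈ B ∧ x ∈ C)) : Better A B C := by
  have hxA : x ∉ A := (mem_coGen.1 hx).1
  refine ⟨insert x A, B, C, isUpperSet_insert_of_mem_coGen hA hx, hB, hC, ?_, phi_insert_lt hxA hbc⟩
  rw [sStarD_insert₁ hxA]
  have := yProfile_nonpos_of_not_mem hB hC (y := x) (fun h => hbc (mem_inter.1 h))
  linarith

/-- Move S2 in the first slot. [this work] -/
theorem better_of_minEl₁ {A B C : Finset (Pd d)} (hA : IsUpperSet (A : Set (Pd d))) (hB : IsUpperSet (B : Set (Pd d)))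
    (hC : IsUpperSet (C : Set (Pd d))) {m : Pd d} (hm : m ∈ minEl A) (hbc : m ∈ B ∧ m ∈ C) : Better A B C := by
  have hmA : m ∈ A := (mem_minEl.1 hm).1
  refine ⟨A.erase m, B, C, isUpperSet_erase_of_mem_minEl hA hm, hB, hC, ?_, phi_erase_lt hmA hbc.1 hbc.2⟩
  rw [sStarD_erase₁ hmA B C]
  have := yProfile_nonneg_of_mem (A := B) (B := C) (y := m) (mem_inter.2 hbc)
  linarith

/-- **Every triple of up-sets dominates a triple in normal form.** [this work] -/
theorem exists_isNF_le : ∀ (n : ℕ) (A B C : Finset (Pd d)), IsUpperSet (A : Set (Pd d)) → IsUpperSet (B : Set (Pd d)) →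
    IsUpperSet (C : Set (Pd d)) → phi A B C ≤ n → ∃ A' B' C' : Finset (Pd d), IsNF A' B' C' ∧ sStarD A' B' C' ≤ sStarD A B C := by
  intro n
  induction n with
  | zero =>
    intro A B C hA hB hC hφ
    exact step A B C hA hB hC fun hb => by obtain ⟨_, _, _, _, _, _, _, hlt⟩ := hb; omega
  | succ n ih =>
    intro A B C hA hB hC hφ
    refine step A B C hA hB hC fun hb => ?_
    obtain ⟨A₁, B₁, C₁, hA₁, hB₁, hC₁, hS, hlt⟩ := hb
    obtain ⟨A', B', C', hnf, hS'⟩ := ih A₁ B₁ C₁ hA₁ hB₁ hC₁ (by omega)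
    exact ⟨A', B', C', hnf, le_trans hS' hS⟩
where
  /-- one step: either the triple is in normal form or a move applies -/
  step (A B C : Finset (Pd d)) (hA : IsUpperSet (A : Set (Pd d))) (hB : IsUpperSet (B : Set (Pd d)))
      (hC : IsUpperSet (C : Set (Pd d)))
      (k : Better A B C → ∃ A' B' C' : Finset (Pd d), IsNF A' B' C' ∧ sStarD A' B' C' ≤ sStarD A B C) :
      ∃ A' B' C' : Finset (Pd d), IsNF A' B' C' ∧ sStarD A' B' C' ≤ sStarD A B C := by
    by_cases h1 : ∀ x ∈ coGen A, x ∈ B ∧ x ∈ C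
    · by_cases h2 : ∀ x ∈ coGen B, x ∈ A ∧ x ∈ C
      · by_cases h3 : ∀ x ∈ coGen C, x ∈ A ∧ x ∈ B
        · by_cases h4 : ∀ m ∈ minEl A, ¬ (m ∈ B ∧ m ∈ C)
          · by_cases h5 : ∀ m ∈ minEl B, ¬ (m ∈ A ∧ m ∈ C)
            · by_cases h6 : ∀ m ∈ minEl C, ¬ (m ∈ A ∧ m ∈ B)
              · exact ⟨A, B, C, ⟨hA, hB, hC, h1, h2, h3, h4, h5, h6⟩, le_refl _⟩
              · push Not at h6; obtain ⟨m, hm, hh⟩ := h6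
                exact k (Better.swap23 (Better.swap12 (better_of_minEl₁ hC hA hB hm ⟨hh.1, hh.2⟩)))
            · push Not at h5; obtain ⟨m, hm, hh⟩ := h5
              exact k (Better.swap12 (better_of_minEl₁ hB hA hC hm ⟨hh.1, hh.2⟩))
          · push Not at h4; obtain ⟨m, hm, hh⟩ := h4
            exact k (better_of_minEl₁ hA hB hC hm ⟨hh.1, hh.2⟩)
        · push Not at h3; obtain ⟨x, hx, hh⟩ := h3
          exact k (Better.swap23 (Better.swap12 (better_of_coGen₁ hC hA hB hx fun h => hh h.1 h.2)))
      · push Not at h2; obtain ⟨x, hx, hh⟩ := h2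
        exact k (Better.swap12 (better_of_coGen₁ hB hA hC hx fun h => hh h.1 h.2))
    · push Not at h1; obtain ⟨x, hx, hh⟩ := h1
      exact k (better_of_coGen₁ hA hB hC hx fun h => hh h.1 h.2)

/-! ### The pair conditions -/

/-- `Free N m`: the point `m` is incomparable to every element of `N`. [this work] -/
def Free (N : Finset (Pd d)) (m : Pd d) : Prop := ∀ z ∈ N, ¬ m ≤ z ∧ ¬ z ≤ m

/-- **The pair conditions** satisfied by the two smaller slots of a triple in normal form: both up-sets, mutually saturated (the maximal
non-elements of each lie in the other), every minimal element of one lying in the other is free with respect to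
`N = coGen A ∪ coGen B`, and there is a free antichain at least as large as `coGen A` and as `coGen B`. [this work] -/
structure PairCond (A B : Finset (Pd d)) : Prop where
  upA : IsUpperSet (A : Set (Pd d))
  upB : IsUpperSet (B : Set (Pd d))
  genA : coGen A ⊆ B
  genB : coGen B ⊆ A
  minA : ∀ m ∈ minEl A, m ∈ B → Free (coGen A ∪ coGen B) m
  minB : ∀ m ∈ minEl B, m ∈ A → Free (coGen A ∪ coGen B) m
  big : ∃ Q : Finset (Pd d), (∀ q ∈ Q, Free (coGen A ∪ coGen B) q) ∧ IsAntichain (· ≤ ·) (Q : Set (Pd d)) ∧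
    (coGen A).card ≤ Q.card ∧ (coGen B).card ≤ Q.card

/-- **From normal form to the pair conditions** (third slot with the most maximal non-elements). [this work] -/
theorem pairCond_of_isNF {A B C : Finset (Pd d)} (h : IsNF A B C) (hAC : (coGen A).card ≤ (coGen C).card)
    (hBC : (coGen B).card ≤ (coGen C).card) : PairCond A B where
  upA := h.upA
  upB := h.upB
  genA := fun x hx => (h.s1A x hx).1
  genB := fun x hx => (h.s1B x hx).1
  minA := by
    intro m hm hmB z hz
    have hmA : m ∈ A := (mem_minEl.1 hm).1
    have hmC : m ∉ C := fun hmC => h.s2A m hm ⟨hmB, hmC⟩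
    rcases mem_union.1 hz with hz | hz
    · exact ⟨fun hle => (mem_coGen.1 hz).1 (h.upA hle hmA), fun hle => hmC (h.upC hle (h.s1A z hz).2)⟩
    · exact ⟨fun hle => (mem_coGen.1 hz).1 (h.upB hle hmB), fun hle => hmC (h.upC hle (h.s1B z hz).2)⟩
  minB := by
    intro m hm hmA z hz
    have hmB : m ∈ B := (mem_minEl.1 hm).1
    have hmC : m ∉ C := fun hmC => h.s2B m hm ⟨hmA, hmC⟩
    rcases mem_union.1 hz with hz | hz
    · exact ⟨fun hle => (mem_coGen.1 hz).1 (h.upA hle hmA), fun hle => hmC (h.upC hle (h.s1A z hz).2)⟩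
    · exact ⟨fun hle => (mem_coGen.1 hz).1 (h.upB hle hmB), fun hle => hmC (h.upC hle (h.s1B z hz).2)⟩
  big := by
    refine ⟨coGen C, fun q hq z hz => ?_, isAntichain_coGen C, hAC, hBC⟩
    have hqC : q ∉ C := (mem_coGen.1 hq).1
    have hqA : q ∈ A := (h.s1C q hq).1
    have hqB : q ∈ B := (h.s1C q hq).2
    rcases mem_union.1 hz with hz | hz
    · exact ⟨fun hle => (mem_coGen.1 hz).1 (h.upA hle hqA), fun hle => hqC (h.upC hle (h.s1A z hz).2)⟩
    · exact ⟨fun hle => (mem_coGen.1 hz).1 (h.upB hle hqB), fun hle => hqC (h.upC hle (h.s1B z hz).2)⟩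

/-- **PAIR SATURATION**: if the y-profile of every pair of up-sets satisfying `PairCond` lies in the dual cone of the up-sets, then
`PatternPos d`. [this work] -/
theorem patternPos_of_pairCond (H : ∀ A B : Finset (Pd d), PairCond A B → InDual (yProfile A B)) : PatternPos d := by
  intro A B C hA hB hC
  obtain ⟨A', B', C', hnf, hle⟩ := exists_isNF_le (phi A B C) A B C hA hB hC (le_refl _)
  refine le_trans ?_ hle
  -- put the slot with the most maximal non-elements last
  by_cases hc : (coGen A').card ≤ (coGen C').card ∧ (coGen B').card ≤ (coGen C').card
  · exact sStarD_nonneg_of_inDual (H A' B' (pairCond_of_isNF hnf hc.1 hc.2)) hnf.upC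
  · by_cases ha : (coGen B').card ≤ (coGen A').card ∧ (coGen C').card ≤ (coGen A').card
    · -- slot A' largest: use the triple (B', C', A')
      rw [sStarD_swap12, sStarD_swap23]
      exact sStarD_nonneg_of_inDual (H B' C' (pairCond_of_isNF hnf.swap12.swap23 ha.1 ha.2)) hnf.upA
    · -- slot B' largest: use the triple (A', C', B')
      have hb : (coGen A').card ≤ (coGen B').card ∧ (coGen C').card ≤ (coGen B').card := by omega
      rw [sStarD_swap23]
      exact sStarD_nonneg_of_inDual (H A' C' (pairCond_of_isNF hnf.swap23 hb.1 hb.2)) hnf.upB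

end Summit.CriticalPhenomena.PercolationContinuityZ3.Theorems.SahiGridPattern
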